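import Mathlib
import Summits.Ventures.LatticeQCDFlow.TrivializingMaps.LightConeClustering
import Summits.Ventures.LatticeQCDFlow.TrivializingMaps.StrongCouplingLightCone
import HarnessLib

/-!
HONEST FRAMING: exact (Metropolis-corrected) sampling algorithms for lattice gauge theory; figures of
merit are autocorrelation/cost numbers at stated couplings and volumes; no continuum-physics claim.

# StrongCouplingDecorrelation — exponential clustering of the periodic SU(n) Wilson measure at strong
# coupling from the light cone of Lüscher's trivializing flow (THEORY-1.md §27, THEOREM C-G)

Proposed tree path: `Summits/Ventures/LatticeQCDFlow/TrivializingMaps/StrongCouplingDecorrelation.lean`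
(OURS — venture work, never `Literature/`). Cell `lqcd-flow` (pub-lqcd), unit `pub-lqcd-theory1-g18`,
2026-08-21.  Imports: Mathlib, HarnessLib, the tree files `LightConeClustering` (THEOREM C: an exact
trivializing map with a light cone forces clustering of its target) and `StrongCouplingLightCone`
(THEOREM L-G: the exponential light cone of the strong-coupling trivializing flow, constants `K_G`, `M_G`
independent of the volume; `StrongCoupling.exists_trivializingMap_expLightCone`).  Everything PROVED,
0 sorries, no new definitions.

## THEOREM C-G (`StrongCoupling.abs_cov_boltzmann_le`)

`d, n ≥ 1`, any `L ≥ 1`, any basis `B` of `su(n)`, `|β| < β₀(d,n,B) = (n⁸ θ₁ 3⁵ + 1)⁻¹`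
(`StrongCoupling.beta0`), any `λ ≥ 1` with `2|β| θ₁ λ² < 1`, any `m`.  Let
`μ_β = boltzmannMeasure (β · S_W)` be the normalised periodic Wilson law `Z⁻¹ e^{-β S_W(U)} ∏ dU` on
`SU(n)^{links of (ℤ/L)^d}` (`S_W = ambWilsonAction ∘ coeConfig`).  For bounded measurable observables
`|A| ≤ a`, `|B| ≤ b` that are link-Lipschitz (`ℓ_A` on the link set `S_A`, `ℓ_B` on `S_B`, Frobenius
norm) with `S_A`, `S_B` at plaquette distance `> 2m`:

  `|∫ A B dμ_β - ∫ A dμ_β ∫ B dμ_β| ≤ 2 (ℓ_A b + a ℓ_B) · 2n e^{n K_G(λ) + M_G} · λ^{-m}`.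

Every constant is independent of `L`: exponential clustering of the finite-volume periodic Wilson
measure, UNIFORMLY IN THE VOLUME, with rate `½ log λ` per unit plaquette distance for every admissible
`λ < (2|β|θ₁)^{-1/2}`, i.e. a correlation-length bound `ξ(β) ≤ 4 / log (1 / (2|β|θ₁))` plaquette steps
on the whole strong-coupling disc of THEOREM L-G.

PROOF: THEOREM L-G gives a trivializing map `Φ₁` of `β S_W` with the level-form light cone
`2n e^{nK_G+M_G} λ^{-lvl}`; THEOREM C (`abs_cov_boltzmann_le_of_levelCone`) turns it into the bound.
No cluster expansion, no polymer combinatorics: flow ODE + Grönwall light cone + independence of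
disjoint blocks of i.i.d. Haar links.

## Honest numbers

This is a STRUCTURE theorem.  Its disc `|β| < β₀(d,n,B)` is THEOREM L-G's (tiny: `β₀ ≤ 3^{-5} n^{-8}`),
far inside the discs where strong-coupling cluster expansions converge, and its rate `½ log λ ≤
¼ log (1/(2|β|θ₁))` per plaquette step is weaker than the Osterwalder–Seiler rate `4 log (1/(Cβ))` per
lattice step.  The tree's Literature already PROVES strong-coupling clustering by the cluster expansion
for free boundary conditions on cubes of `ℤ^d` (`osterwalderSeiler_clustering_supNorm_holds`,
`StrongCouplingExpansion`) and records the periodic / infinite-volume SU(N) statement of Shen–Zhu–Zhu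
(`shenZhuZhu_strongCoupling_holds`); nothing is imported from them.  What is new is the MECHANISM and
what it says for the venture: the exact sampler map of THEOREM L-G is a quasi-local coding of the
Wilson measure by i.i.d. Haar links with exponential tails (compare Spinka, arXiv:1803.10578 Thm. 1.1,
finitary codings of exponentially mixing finite-state Markov fields), and the locality scale of ANY exact
trivializing map and the correlation length of its target are the same scale up to the factor 2 of
PROPOSITIONS R / R′ — the scale in which the venture's footprint and cost laws (THEORY-1 §12.5, §13.5)
are written.  NOT CLAIMED: any number for `K_G`, `M_G`, `ξ` at a physical `β`; anything at `|β| ≥ β₀`;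
anything about truncated or machine-learned maps' autocorrelations.
-/

namespace Summit.Ventures.LatticeQCDFlow.TrivializingMaps

open MeasureTheory
open scoped Matrix Matrix.Norms.Frobenius
open Literature.MathematicalPhysics.QuantumFieldTheory
open Literature.MathematicalPhysics.QuantumFieldTheory.Luscher2010
open Literature.MathematicalPhysics.QuantumFieldTheory.WilsonFlow (coeConfig coeConfig_apply)
open GradedSeries AnalyticSeries

namespace StrongCoupling

variable {d L n : ℕ} [NeZero L]

/-- **THEOREM C-G — exponential clustering of the periodic Wilson measure at strong coupling, uniformly
in the volume.**  For `|β| < β₀(d,n,B)`, `λ ≥ 1` with `2|β|θ₁λ² < 1`, bounded measurable link-Lipschitz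
observables `A` (`|A| ≤ a`, constant `ℓ_A` on `S_A`) and `B` (`|B| ≤ b`, `ℓ_B` on `S_B`) with supports at
plaquette distance `> 2m`:
`|Cov_{μ_β}(A, B)| ≤ 2 (ℓ_A b + a ℓ_B) · 2n e^{nK_G(λ)+M_G} λ^{-m}`.  [ours] -/
theorem abs_cov_boltzmann_le (hn : n ≠ 0) (B : SuBasis n) {β : ℝ} (hβ : |β| < beta0 d n B)
    {lam : ℝ} (hlam : 1 ≤ lam) (hr : 2 * |β| * theta1 d n B * lam ^ 2 < 1) (m : ℕ)
    {A Bo : GaugeConfig d L (Matrix.specialUnitaryGroup (Fin n) ℂ) → ℝ} (hAm : Measurable A)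
    (hBm : Measurable Bo) {a b ℓA ℓB : ℝ} (hAa : ∀ U, |A U| ≤ a) (hBb : ∀ U, |Bo U| ≤ b)
    {SA SB : Set (Edge d L)}
    (hAlip : ∀ (U U' : GaugeConfig d L (Matrix.specialUnitaryGroup (Fin n) ℂ)) (η' : ℝ), 0 ≤ η' →
      (∀ e ∈ SA, ‖coeConfig U e - coeConfig U' e‖ ≤ η') → |A U - A U'| ≤ ℓA * η')
    (hBlip : ∀ (U U' : GaugeConfig d L (Matrix.specialUnitaryGroup (Fin n) ℂ)) (η' : ℝ), 0 ≤ η' →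
      (∀ e ∈ SB, ‖coeConfig U e - coeConfig U' e‖ ≤ η') → |Bo U - Bo U'| ≤ ℓB * η')
    (hsep : ∀ e ∈ SA, ∀ e' ∈ SB, e' ∉ linkBall (2 * m) e) :
    |∫ U, A U * Bo U ∂(boltzmannMeasure fun U : GaugeConfig d L (Matrix.specialUnitaryGroup (Fin n) ℂ) =>
          β * ambWilsonAction (coeConfig U)) -
        (∫ U, A U ∂(boltzmannMeasure fun U : GaugeConfig d L (Matrix.specialUnitaryGroup (Fin n) ℂ) =>
          β * ambWilsonAction (coeConfig U))) *
        ∫ U, Bo U ∂(boltzmannMeasure fun U : GaugeConfig d L (Matrix.specialUnitaryGroup (Fin n) ℂ) =>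
          β * ambWilsonAction (coeConfig U))| ≤
      2 * (ℓA * b + a * ℓB) * (2 * n * Real.exp (n * KG d n B β lam + MG d n B β) / lam ^ m) := by
  obtain ⟨Φ, htriv, hcone⟩ := exists_trivializingMap_expLightCone (d := d) (L := L) hn B hβ
  exact abs_cov_boltzmann_le_of_levelCone htriv (zero_lt_one.trans_le hlam) (by positivity)
    (hcone lam hlam hr) m hAm hBm hAa hBb hAlip hBlip hsep

/-- **Uniformity in the volume, displayed.**  The clustering constant of THEOREM C-G is one real number
`C(d,n,B,β,λ)` serving every `L ≥ 1` and every `m`: the finite-volume periodic Wilson measures cluster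
exponentially at a volume-independent rate `½ log λ` per unit plaquette distance. [ours] -/
theorem exists_clustering_constant_uniform (hn : n ≠ 0) (B : SuBasis n) {β : ℝ}
    (hβ : |β| < beta0 d n B) {lam : ℝ} (hlam : 1 ≤ lam) (hr : 2 * |β| * theta1 d n B * lam ^ 2 < 1) :
    ∃ C : ℝ, 0 ≤ C ∧ ∀ (L : ℕ) [NeZero L] (m : ℕ)
      (A Bo : GaugeConfig d L (Matrix.specialUnitaryGroup (Fin n) ℂ) → ℝ), Measurable A → Measurable Bo →
      ∀ (a b ℓA ℓB : ℝ), (∀ U, |A U| ≤ a) → (∀ U, |Bo U| ≤ b) →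
      ∀ (SA SB : Set (Edge d L)),
      (∀ (U U' : GaugeConfig d L (Matrix.specialUnitaryGroup (Fin n) ℂ)) (η' : ℝ), 0 ≤ η' →
        (∀ e ∈ SA, ‖coeConfig U e - coeConfig U' e‖ ≤ η') → |A U - A U'| ≤ ℓA * η') →
      (∀ (U U' : GaugeConfig d L (Matrix.specialUnitaryGroup (Fin n) ℂ)) (η' : ℝ), 0 ≤ η' →
        (∀ e ∈ SB, ‖coeConfig U e - coeConfig U' e‖ ≤ η') → |Bo U - Bo U'| ≤ ℓB * η') →
      (∀ e ∈ SA, ∀ e' ∈ SB, e' ∉ linkBall (2 * m) e) →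
      |∫ U, A U * Bo U ∂(boltzmannMeasure fun U : GaugeConfig d L (Matrix.specialUnitaryGroup (Fin n) ℂ) =>
            β * ambWilsonAction (coeConfig U)) -
          (∫ U, A U ∂(boltzmannMeasure fun U : GaugeConfig d L (Matrix.specialUnitaryGroup (Fin n) ℂ) =>
            β * ambWilsonAction (coeConfig U))) *
          ∫ U, Bo U ∂(boltzmannMeasure fun U : GaugeConfig d L (Matrix.specialUnitaryGroup (Fin n) ℂ) =>
            β * ambWilsonAction (coeConfig U))| ≤ 2 * (ℓA * b + a * ℓB) * (C / lam ^ m) := by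
  refine ⟨2 * n * Real.exp (n * KG d n B β lam + MG d n B β), by positivity, ?_⟩
  intro L _ m A Bo hAm hBm a b ℓA ℓB hAa hBb SA SB hAlip hBlip hsep
  exact abs_cov_boltzmann_le hn B hβ hlam hr m hAm hBm hAa hBb hAlip hBlip hsep

end StrongCoupling

end Summit.Ventures.LatticeQCDFlow.TrivializingMaps
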